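import Mathlib
import Summits.Ventures.PercRepro2.Defs
import Summits.Ventures.PercRepro2.Harris
import Summits.Ventures.PercRepro2.Graph
import Summits.Ventures.PercRepro2.Induced
import Summits.Ventures.PercRepro2.VdBKahn
import Summits.Ventures.PercRepro2.ReimerVdBK
import Summits.Ventures.PercRepro2.ReimerVdBKAssoc

/-!
# `(R-1.2)` when the root is a leaf: the two worlds separate at the root edge
(blind cell PercRepro2, mine-c g43; `conjectures/MINE-C.md` §52.6 (a))

If the root `s` has a single edge `e₀`, then in every 2-colouring one world sees `e₀` open and the
other sees it closed, and the cluster of `s` in the closed world is `{s}` (`conn_eq_of_closed`).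
So the two-world count splits: with `N A X := #{ω : ω e₀ = true, A ⊆ K₁, X ∩ K₁ = ∅}`,

  `Φ(A, X; B, Y) = [B ⊆ {s}, s ∉ Y] · N A X + [A ⊆ {s}, s ∉ X] · N B Y`   (`reimerCount_rootLeaf`),

the second term coming from the world swap (`count_bar`).  `(R-1.2)` is then a four-case check:
`N` is monotone in its sets, `Q_{A ∪ B} = Q_A` when `B ⊆ {s}`, and `X ↦ N ∅ X` is SUBMODULAR
(`R_{X ∪ Y} = R_X ∩ R_Y`, `R_X ∪ R_Y ⊆ R_{X ∩ Y}`, inclusion–exclusion) — `rvdBK_of_rootLeaf`.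
This is the mechanism that makes `(R-1.2)` trivial on every tree (the worlds never share a
branch); the content of `(R-1.2)` lies where the two worlds share cycles (`MINE-C.md` §52.6) —
where, by `MINE-C.md` §52.7, the conditional-association hypotheses `CNA` / `CPA` of
`ReimerVdBKAssoc.lean` fail from 6 vertices on while `(R-1.2)` itself holds.
-/

namespace Summit.Ventures.PercRepro2

namespace ReimerVdBK

open Classical

variable {V : Type*} {E : Type*} [Fintype E] [DecidableEq E] [Fintype V] [DecidableEq V]

variable (ends : E → Sym2 V) (s : V)

/-! ## Counting lemmas -/

/-- Inclusion–exclusion for counts. -/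
lemma count_union_add_count_inter (A B : Set (Config E)) :
    count (A ∪ B) + count (A ∩ B) = count A + count B := by
  unfold count
  rw [← Finset.sum_add_distrib, ← Finset.sum_add_distrib]
  refine Finset.sum_congr rfl fun ω _ => ?_
  by_cases hA : ω ∈ A <;> by_cases hB : ω ∈ B <;> simp [hA, hB]

/-- A count splits along the value of one edge. -/
lemma count_eq_add_split (A : Set (Config E)) (e : E) :
    count A = count (A ∩ {ω | ω e = true}) + count (A ∩ {ω | ω e = false}) := by
  unfold count
  rw [← Finset.sum_add_distrib]
  refine Finset.sum_congr rfl fun ω _ => ?_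
  by_cases hA : ω ∈ A <;> cases h : ω e <;> simp [hA, h]

/-- An empty event has count `0`. -/
lemma count_eq_zero_of_subset_empty {A : Set (Config E)} (h : A ⊆ ∅) : count A = 0 := by
  unfold count
  refine Finset.sum_eq_zero fun ω _ => ?_
  have : ω ∉ A := fun hω => h hω
  simp [this]

/-! ## The closed world of a leaf root -/

omit [Fintype E] [DecidableEq E] [Fintype V] [DecidableEq V] in
/-- If the only edge at `s` is `e₀` and `e₀` is closed, `s` is connected to nothing but itself. -/
lemma conn_eq_of_closed {e₀ : E} (hs : ∀ e, s ∈ ends e → e = e₀) {ω : Config E}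
    (hω : ω e₀ = false) {x : V} (h : Conn ends ω s x) : x = s := by
  obtain ⟨w⟩ := h
  cases w with
  | nil => rfl
  | cons hadj _ =>
    exfalso
    rw [openGraph_adj] at hadj
    obtain ⟨_, e, he, hends⟩ := hadj
    have hse : s ∈ ends e := by rw [hends]; exact Sym2.mem_mk_left _ _
    rw [hs e hse] at he
    rw [hω] at he
    exact Bool.false_ne_true he

omit [Fintype E] [DecidableEq E] [Fintype V] [DecidableEq V] in
/-- With `e₀` closed, `Q_A` holds iff `A ⊆ {s}`. -/
lemma mem_connAll_of_closed {e₀ : E} (hs : ∀ e, s ∈ ends e → e = e₀) {ω : Config E}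
    (hω : ω e₀ = false) (A : Finset V) : ω ∈ connAll ends s A ↔ A ⊆ {s} := by
  constructor
  · intro h a ha
    rw [Finset.mem_singleton]
    exact conn_eq_of_closed ends s hs hω (h a ha)
  · intro h a ha
    rw [Finset.subset_singleton_iff'] at h
    rw [h a ha]
    exact conn_refl ends ω s

omit [Fintype E] [DecidableEq E] [Fintype V] [DecidableEq V] in
/-- With `e₀` closed, `R_X` holds iff `s ∉ X`. -/
lemma mem_avoidAll_of_closed {e₀ : E} (hs : ∀ e, s ∈ ends e → e = e₀) {ω : Config E}
    (hω : ω e₀ = false) (X : Finset V) : ω ∈ avoidAll ends s X ↔ s ∉ X := by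
  constructor
  · intro h hsX
    exact h s hsX (conn_refl ends ω s)
  · intro h x hx hc
    rw [conn_eq_of_closed ends s hs hω hc] at hx
    exact h hx

omit [Fintype E] [DecidableEq E] [Fintype V] [DecidableEq V] in
/-- `s ∈ X` kills `R_X`. -/
lemma avoidAll_eq_empty_of_mem {X : Finset V} (h : s ∈ X) : avoidAll ends s X = ∅ := by
  ext ω
  simp only [Set.mem_empty_iff_false, iff_false]
  intro hω
  exact hω s h (conn_refl ends ω s)

omit [Fintype E] [DecidableEq E] [Fintype V] in
/-- Vertices of `B ⊆ {s}` are always reached: `Q_{A ∪ B} = Q_A`. -/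
lemma connAll_union_of_subset_singleton {A B : Finset V} (hB : B ⊆ {s}) :
    connAll ends s (A ∪ B) = connAll ends s A := by
  ext ω
  simp only [connAll, Set.mem_setOf_eq, Finset.mem_union]
  constructor
  · intro h a ha
    exact h a (Or.inl ha)
  · intro h a ha
    rcases ha with ha | ha
    · exact h a ha
    · rw [Finset.subset_singleton_iff'] at hB
      rw [hB a ha]
      exact conn_refl ends ω s

/-! ## The one-world count `N` and its properties -/

/-- `N A X = #{ω : ω e₀ = true, A ⊆ K₁, X ∩ K₁ = ∅}` — the count of the world that sees the root
edge open. -/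
noncomputable def oneWorld (e₀ : E) (A X : Finset V) : ℕ :=
  count (connAll ends s A ∩ avoidAll ends s X ∩ {ω | ω e₀ = true})

omit [Fintype V] [DecidableEq V] in
/-- `N` is monotone: fewer targets, fewer avoided vertices — more configurations. -/
lemma oneWorld_mono (e₀ : E) {A A' X X' : Finset V} (hA : A' ⊆ A) (hX : X' ⊆ X) :
    oneWorld ends s e₀ A X ≤ oneWorld ends s e₀ A' X' :=
  count_mono (Set.inter_subset_inter (Set.inter_subset_inter (connAll_anti ends s hA)
    (avoidAll_anti ends s hX)) le_rfl)

omit [Fintype V] [DecidableEq V] in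
/-- `s ∈ X` kills `N`. -/
lemma oneWorld_eq_zero_of_mem (e₀ : E) (A : Finset V) {X : Finset V} (h : s ∈ X) :
    oneWorld ends s e₀ A X = 0 := by
  unfold oneWorld
  rw [avoidAll_eq_empty_of_mem ends s h]
  exact count_eq_zero_of_subset_empty (by simp)

omit [Fintype V] in
/-- Targets in `{s}` are free. -/
lemma oneWorld_union_of_subset_singleton (e₀ : E) {A B : Finset V} (hB : B ⊆ {s}) (X : Finset V) :
    oneWorld ends s e₀ (A ∪ B) X = oneWorld ends s e₀ A X := by
  unfold oneWorld
  rw [connAll_union_of_subset_singleton ends s hB]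

omit [Fintype V] in
/-- Targets in `{s}` are free (singleton form). -/
lemma oneWorld_eq_of_subset_singleton (e₀ : E) {A : Finset V} (hA : A ⊆ {s}) (X : Finset V) :
    oneWorld ends s e₀ A X = oneWorld ends s e₀ ∅ X := by
  have h := oneWorld_union_of_subset_singleton ends s e₀ (A := ∅) hA X
  rwa [Finset.empty_union] at h

omit [Fintype V] in
/-- **Submodularity** of `X ↦ N ∅ X`: `N ∅ X + N ∅ Y ≤ N ∅ (X ∩ Y) + N ∅ (X ∪ Y)`. -/
lemma oneWorld_submodular (e₀ : E) (X Y : Finset V) :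
    oneWorld ends s e₀ ∅ X + oneWorld ends s e₀ ∅ Y ≤
      oneWorld ends s e₀ ∅ (X ∩ Y) + oneWorld ends s e₀ ∅ (X ∪ Y) := by
  unfold oneWorld
  simp only [connAll_empty, Set.univ_inter]
  set H : Set (Config E) := {ω | ω e₀ = true}
  have hie := count_union_add_count_inter (avoidAll ends s X ∩ H) (avoidAll ends s Y ∩ H)
  have h1 : avoidAll ends s X ∩ H ∩ (avoidAll ends s Y ∩ H) = avoidAll ends s (X ∪ Y) ∩ H := by
    rw [avoidAll_union]; ext ω; simp only [Set.mem_inter_iff]; tauto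
  have h2 : avoidAll ends s X ∩ H ∪ avoidAll ends s Y ∩ H ⊆ avoidAll ends s (X ∩ Y) ∩ H := by
    rintro ω (⟨h, hH⟩ | ⟨h, hH⟩)
    · exact ⟨avoidAll_anti ends s Finset.inter_subset_left h, hH⟩
    · exact ⟨avoidAll_anti ends s Finset.inter_subset_right h, hH⟩
  rw [h1] at hie
  have h3 := count_mono h2
  omega

/-! ## The split of the Reimer count at a leaf root -/

omit [Fintype E] [DecidableEq E] [Fintype V] in
/-- The half of `twoWorld` that sees `e₀` open in world 1. -/
lemma twoWorld_inter_open_eq {e₀ : E} (hs : ∀ e, s ∈ ends e → e = e₀) (A X B Y : Finset V) :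
    twoWorld ends s A X B Y ∩ {ω | ω e₀ = true} =
      if B ⊆ {s} ∧ s ∉ Y then connAll ends s A ∩ avoidAll ends s X ∩ {ω | ω e₀ = true} else ∅ := by
  ext ω
  simp only [twoWorld, Set.mem_inter_iff, mem_bar, Set.mem_setOf_eq]
  constructor
  · rintro ⟨⟨⟨hQ, hR⟩, hB, hY⟩, he⟩
    have he' : ω e₀ = true := he
    have hc : compl ω e₀ = false := by simp [compl, he']
    rw [mem_connAll_of_closed ends s hs hc] at hB
    rw [mem_avoidAll_of_closed ends s hs hc] at hY
    rw [if_pos ⟨hB, hY⟩]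
    exact ⟨⟨hQ, hR⟩, he⟩
  · intro h
    split_ifs at h with hBY
    · obtain ⟨⟨hQ, hR⟩, he⟩ := h
      have he' : ω e₀ = true := he
      have hc : compl ω e₀ = false := by simp [compl, he']
      refine ⟨⟨⟨hQ, hR⟩, ?_, ?_⟩, he⟩
      · rw [mem_connAll_of_closed ends s hs hc]; exact hBY.1
      · rw [mem_avoidAll_of_closed ends s hs hc]; exact hBY.2
    · exact absurd h (Set.notMem_empty ω)

omit [Fintype E] [DecidableEq E] [Fintype V] [DecidableEq V] in
/-- The half that sees `e₀` closed in world 1 is the world swap of the other half. -/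
lemma twoWorld_inter_closed_eq (e₀ : E) (A X B Y : Finset V) :
    twoWorld ends s A X B Y ∩ {ω | ω e₀ = false} =
      bar (twoWorld ends s B Y A X ∩ {ω | ω e₀ = true}) := by
  ext ω
  simp only [twoWorld, Set.mem_inter_iff, mem_bar, Set.mem_setOf_eq, compl_compl]
  constructor
  · rintro ⟨⟨⟨hQ, hR⟩, hB, hY⟩, he⟩
    refine ⟨⟨⟨hB, hY⟩, hQ, hR⟩, ?_⟩
    simp [compl, he]
  · rintro ⟨⟨⟨hB, hY⟩, hQ, hR⟩, he⟩
    refine ⟨⟨⟨hQ, hR⟩, hB, hY⟩, ?_⟩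
    simp only [compl] at he
    cases h : ω e₀
    · rfl
    · rw [h] at he; exact absurd he (by decide)

omit [Fintype V] in
/-- **The split at a leaf root**:
`Φ(A, X; B, Y) = [B ⊆ {s}, s ∉ Y] · N A X + [A ⊆ {s}, s ∉ X] · N B Y`. -/
theorem reimerCount_rootLeaf {e₀ : E} (hs : ∀ e, s ∈ ends e → e = e₀) (A X B Y : Finset V) :
    reimerCount ends s A X B Y =
      (if B ⊆ {s} ∧ s ∉ Y then oneWorld ends s e₀ A X else 0) +
        (if A ⊆ {s} ∧ s ∉ X then oneWorld ends s e₀ B Y else 0) := by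
  unfold reimerCount
  rw [count_eq_add_split _ e₀, twoWorld_inter_open_eq ends s hs, twoWorld_inter_closed_eq ends s e₀,
    count_bar, twoWorld_inter_open_eq ends s hs]
  unfold oneWorld
  congr 1 <;> split_ifs <;> simp [count_eq_zero_of_subset_empty]

/-! ## The theorem -/

omit [Fintype V] in
/-- **`(R-1.2)` when the root is a leaf**: if `e₀` is the only edge at `s`, then
`Φ(A, X; B, Y) ≤ Φ(A ∪ B, X ∩ Y; ∅, X ∪ Y)` — the two worlds separate at `e₀`, and the four
cases reduce to monotonicity and the submodularity of `X ↦ #{s ↮ X}`. -/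
theorem rvdBK_of_rootLeaf {e₀ : E} (hs : ∀ e, s ∈ ends e → e = e₀) (A X B Y : Finset V) :
    RvdBK ends s A X B Y := by
  unfold RvdBK
  rw [reimerCount_rootLeaf ends s hs, reimerCount_rootLeaf ends s hs]
  have hmono := oneWorld_mono ends s e₀ (A := A) (A' := A) (X := X) (X' := X ∩ Y) le_rfl
    Finset.inter_subset_left
  have hmonoB := oneWorld_mono ends s e₀ (A := B) (A' := B) (X := Y) (X' := X ∩ Y) le_rfl
    Finset.inter_subset_right
  have hsub := oneWorld_submodular ends s e₀ X Y
  by_cases hB : B ⊆ {s} ∧ s ∉ Y <;> by_cases hA : A ⊆ {s} ∧ s ∉ X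
  · -- both worlds are trivial: submodularity
    have hsXY : s ∉ X ∪ Y := by
      rw [Finset.mem_union]; exact fun h => h.elim hA.2 hB.2
    have hsXY' : s ∉ X ∩ Y := fun h => hA.2 (Finset.mem_inter.1 h).1
    have hAB : A ∪ B ⊆ {s} := Finset.union_subset hA.1 hB.1
    rw [if_pos hB, if_pos hA,
      if_pos (show (∅ : Finset V) ⊆ {s} ∧ s ∉ X ∪ Y from ⟨Finset.empty_subset _, hsXY⟩),
      if_pos (show A ∪ B ⊆ {s} ∧ s ∉ X ∩ Y from ⟨hAB, hsXY'⟩),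
      oneWorld_union_of_subset_singleton ends s e₀ hB.1]
    simp only [oneWorld_eq_of_subset_singleton ends s e₀ hA.1,
      oneWorld_eq_of_subset_singleton ends s e₀ hB.1]
    exact hsub
  · -- only world 1 is nontrivial
    rw [if_pos hB, if_neg hA, add_zero]
    by_cases hsX : s ∈ X
    · rw [oneWorld_eq_zero_of_mem ends s e₀ A hsX]; exact Nat.zero_le _
    · have hsXY : s ∉ X ∪ Y := by
        rw [Finset.mem_union]; exact fun h => h.elim hsX hB.2
      rw [if_pos (show (∅ : Finset V) ⊆ {s} ∧ s ∉ X ∪ Y from ⟨Finset.empty_subset _, hsXY⟩),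
        oneWorld_union_of_subset_singleton ends s e₀ hB.1]
      exact hmono.trans (Nat.le_add_right _ _)
  · -- only world 2 is nontrivial
    rw [if_neg hB, if_pos hA, zero_add]
    by_cases hsY : s ∈ Y
    · rw [oneWorld_eq_zero_of_mem ends s e₀ B hsY]; exact Nat.zero_le _
    · have hsXY : s ∉ X ∪ Y := by
        rw [Finset.mem_union]; exact fun h => h.elim hA.2 hsY
      rw [if_pos (show (∅ : Finset V) ⊆ {s} ∧ s ∉ X ∪ Y from ⟨Finset.empty_subset _, hsXY⟩),
        Finset.union_comm, oneWorld_union_of_subset_singleton ends s e₀ hA.1]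
      exact hmonoB.trans (Nat.le_add_right _ _)
  · rw [if_neg hB, if_neg hA]
    exact Nat.zero_le _

end ReimerVdBK

end Summit.Ventures.PercRepro2
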